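import Mathlib.Analysis.Calculus.Taylor
import Mathlib.Analysis.Calculus.IteratedDeriv.Lemmas
import Mathlib.Analysis.Calculus.Deriv.MeanValue
import Mathlib.Analysis.Complex.LocallyUniformLimit
import Mathlib.Analysis.SpecialFunctions.Pow.Real
import HarnessLib

/-!
# The little Bernstein theorem, I: Taylor series of a completely monotone function

Let `G : ℝ → ℝ` be smooth and **completely monotone on `(0, ∞)`**: `(-1)ⁿ G⁽ⁿ⁾(t) ≥ 0` for all
`n` and all `t > 0`.  S. N. Bernstein's "little" theorem [cite: Widder1941, Ch. IV Thm. 3a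
(absolutely monotone functions are analytic, with the Taylor series at `x₀` converging on the
whole interval of length `x₀` to the left endpoint)] says that `G` is real-analytic and that its
Taylor series at `x₀ > 0` has radius of convergence at least `x₀`.  This file proves the
series-level statements:

* `alt_antitoneOn` — each `(-1)ⁿ G⁽ⁿ⁾` is non-increasing on `(0,∞)`;
* `sum_alt_mul_pow_le` — the Taylor bound `∑_{k<N} (-1)ᵏG⁽ᵏ⁾(x₀) rᵏ/k! ≤ G(x₀ - r)`
  (`0 ≤ r < x₀`; Lagrange remainder has the right sign), whence summability
  (`summable_alt_mul_pow`) and the bound on the sum;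
* the complex Taylor series `P x₀ z = ∑ G⁽ᵏ⁾(x₀) (z - x₀)ᵏ / k!` (an explicit parameter with its
  defining equation; no definition is made): holomorphic on the disc
  `ball x₀ x₀` (`differentiableOn_cmTaylor`), bounded there by `G(x₀ - |z - x₀|)`
  (`norm_cmTaylor_le`), and equal to `G` at the real points of `(x₀/2, 2x₀)`
  (`cmTaylor_ofReal_eq_of_mem_Ioo`).

The continuation to the right half-plane (gluing the discs) is in
`Literature/Analysis/Complex/LittleBernsteinHalfPlane.lean`.
-/

noncomputable section

open Set Filter Metric Finset
open scoped Topology BigOperators ContDiff Nat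

namespace Literature.Analysis.Complex

variable {G : ℝ → ℝ}

/-! ### Real-variable facts -/

/-- For a smooth completely monotone `G`, each `(-1)ⁿ G⁽ⁿ⁾` is non-increasing on `(0,∞)` (its
derivative is `-(-1)ⁿ⁺¹G⁽ⁿ⁺¹⁾ ≤ 0`). [cite: Widder1941, Ch. IV §2] -/
theorem alt_antitoneOn (hd : ContDiff ℝ ∞ G)
    (hcm : ∀ (n : ℕ) (t : ℝ), 0 < t → 0 ≤ (-1 : ℝ) ^ n * iteratedDeriv n G t) (n : ℕ) :
    AntitoneOn (fun x => (-1 : ℝ) ^ n * iteratedDeriv n G x) (Ioi 0) := by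
  have hdiff : Differentiable ℝ (iteratedDeriv n G) :=
    hd.differentiable_iteratedDeriv n (mod_cast ENat.coe_lt_top n)
  refine antitoneOn_of_deriv_nonpos (convex_Ioi 0) ((hdiff.const_mul _).continuous.continuousOn)
    ((hdiff.const_mul _).differentiableOn) fun x hx => ?_
  rw [interior_Ioi] at hx
  rw [deriv_const_mul _ (hdiff x), ← iteratedDeriv_succ]
  have := hcm (n + 1) x hx
  rw [pow_succ] at this
  nlinarith

/-- Nonnegativity of the absolute derivatives: `|G⁽ⁿ⁾(t)| = (-1)ⁿ G⁽ⁿ⁾(t)` for `t > 0`. [folklore] -/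
theorem abs_iteratedDeriv_eq (hcm : ∀ (n : ℕ) (t : ℝ), 0 < t → 0 ≤ (-1 : ℝ) ^ n * iteratedDeriv n G t)
    (n : ℕ) {t : ℝ} (ht : 0 < t) : |iteratedDeriv n G t| = (-1 : ℝ) ^ n * iteratedDeriv n G t := by
  have h := hcm n t ht
  rcases neg_one_pow_eq_or ℝ n with hn | hn <;> rw [hn] at h ⊢
  · rw [one_mul] at h ⊢; exact abs_of_nonneg h
  · rw [neg_one_mul] at h ⊢; exact abs_of_nonpos (by linarith)

/-- **Taylor bound with the Lagrange remainder of the right sign.**  For a smooth completely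
monotone `G` on `(0,∞)`, `x₀ > 0` and `0 ≤ r < x₀`:
`∑_{k<N} (-1)ᵏ G⁽ᵏ⁾(x₀) rᵏ / k! ≤ G (x₀ - r)`. [cite: Widder1941, Ch. IV Thm. 3a] -/
theorem sum_alt_mul_pow_le (hd : ContDiff ℝ ∞ G)
    (hcm : ∀ (n : ℕ) (t : ℝ), 0 < t → 0 ≤ (-1 : ℝ) ^ n * iteratedDeriv n G t)
    {x₀ r : ℝ} (hr : 0 ≤ r) (hrx : r < x₀) (N : ℕ) :
    ∑ k ∈ Finset.range N, (-1 : ℝ) ^ k * iteratedDeriv k G x₀ * r ^ k / k ! ≤ G (x₀ - r) := by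
  have hx₀ : 0 < x₀ := hr.trans_lt hrx
  rcases hr.eq_or_lt with rfl | hr0
  · -- `r = 0`: only the `k = 0` term survives
    rw [sub_zero]
    rcases N with _ | N
    · simpa using (by simpa using hcm 0 x₀ hx₀ : 0 ≤ G x₀)
    · rw [Finset.sum_range_succ']
      simp
  rcases N with _ | N
  · simpa using (by simpa using hcm 0 (x₀ - r) (by linarith) : 0 ≤ G (x₀ - r))
  -- Taylor with Lagrange remainder at `x₀`, evaluated at `x = x₀ - r < x₀`
  set x := x₀ - r with hx
  have hxx : x₀ ≠ x := by rw [hx]; linarith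
  have hxpos : 0 < x := by rw [hx]; linarith
  have hcd : ContDiffOn ℝ (N + 1) G (uIcc x₀ x) := (hd.of_le (mod_cast le_top)).contDiffOn
  obtain ⟨ξ, hξ, hrem⟩ := taylor_mean_remainder_lagrange_iteratedDeriv hxx hcd
  -- the Taylor polynomial is our partial sum
  have huniq : UniqueDiffOn ℝ (uIcc x₀ x) := uniqueDiffOn_Icc (by
    rw [min_lt_max]; exact hxx)
  have hT : taylorWithinEval G N (uIcc x₀ x) x₀ x =
      ∑ k ∈ Finset.range (N + 1), (-1 : ℝ) ^ k * iteratedDeriv k G x₀ * r ^ k / k ! := by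
    rw [taylor_within_apply]
    refine Finset.sum_congr rfl fun k _ => ?_
    rw [iteratedDerivWithin_eq_iteratedDeriv huniq (hd.contDiffAt.of_le (mod_cast le_top))
      left_mem_uIcc, smul_eq_mul, show x - x₀ = -r by rw [hx]; ring, neg_pow]
    ring
  -- the remainder is nonnegative
  have hξpos : 0 < ξ := by
    rcases lt_or_gt_of_ne hxx with h | h
    · exact hx₀.trans (by simpa [uIoo, h.le, min_eq_left, max_eq_right] using hξ.1)
    · have : ξ ∈ Ioo x x₀ := by simpa [uIoo, h.le, min_eq_right, max_eq_left] using hξ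
      exact hxpos.trans this.1
  have hR : 0 ≤ iteratedDeriv (N + 1) G ξ * (x - x₀) ^ (N + 1) / (N + 1)! := by
    have h1 : iteratedDeriv (N + 1) G ξ * (x - x₀) ^ (N + 1) =
        ((-1 : ℝ) ^ (N + 1) * iteratedDeriv (N + 1) G ξ) * r ^ (N + 1) := by
      rw [show x - x₀ = -r by rw [hx]; ring, neg_pow]; ring
    rw [h1]
    exact div_nonneg (mul_nonneg (hcm _ _ hξpos) (pow_nonneg hr _)) (by positivity)
  rw [← hT]
  linarith

/-- **Summability of the Taylor series of a completely monotone function** at `x₀` for radii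
`0 ≤ r < x₀`, with the bound `∑ (-1)ᵏ G⁽ᵏ⁾(x₀) rᵏ/k! ≤ G(x₀ - r)` on the sum.
[cite: Widder1941, Ch. IV Thm. 3a] -/
theorem summable_alt_mul_pow (hd : ContDiff ℝ ∞ G)
    (hcm : ∀ (n : ℕ) (t : ℝ), 0 < t → 0 ≤ (-1 : ℝ) ^ n * iteratedDeriv n G t)
    {x₀ r : ℝ} (hr : 0 ≤ r) (hrx : r < x₀) :
    Summable (fun k => (-1 : ℝ) ^ k * iteratedDeriv k G x₀ * r ^ k / k !) ∧
      ∑' k, (-1 : ℝ) ^ k * iteratedDeriv k G x₀ * r ^ k / k ! ≤ G (x₀ - r) := by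
  have hx₀ : 0 < x₀ := hr.trans_lt hrx
  have hnn : ∀ k, 0 ≤ (-1 : ℝ) ^ k * iteratedDeriv k G x₀ * r ^ k / k ! := fun k =>
    div_nonneg (mul_nonneg (hcm k x₀ hx₀) (pow_nonneg hr k)) (by positivity)
  have hbd := sum_alt_mul_pow_le hd hcm hr hrx
  exact ⟨summable_of_sum_range_le hnn hbd, Real.tsum_le_of_sum_range_le hnn hbd⟩

/-- The term bound: `|G⁽ᵏ⁾(x₀)| ρᵏ / k! ≤ G(x₀ - ρ)` for `0 ≤ ρ < x₀` (one term of a nonnegative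
convergent series is at most its sum). [folklore] -/
theorem abs_iteratedDeriv_mul_pow_le (hd : ContDiff ℝ ∞ G)
    (hcm : ∀ (n : ℕ) (t : ℝ), 0 < t → 0 ≤ (-1 : ℝ) ^ n * iteratedDeriv n G t)
    {x₀ ρ : ℝ} (hρ : 0 ≤ ρ) (hρx : ρ < x₀) (k : ℕ) :
    |iteratedDeriv k G x₀| * ρ ^ k / k ! ≤ G (x₀ - ρ) := by
  have hx₀ : 0 < x₀ := hρ.trans_lt hρx
  obtain ⟨hs, hle⟩ := summable_alt_mul_pow hd hcm hρ hρx
  rw [abs_iteratedDeriv_eq hcm k hx₀]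
  refine le_trans ?_ hle
  exact hs.le_tsum k fun j _ =>
    div_nonneg (mul_nonneg (hcm j x₀ hx₀) (pow_nonneg hρ j)) (by positivity)

/-! ### The complex Taylor series on the disc `|z - x₀| < x₀` -/

/-! In the statements below the complex Taylor series is an explicit parameter
`P : ℝ → ℂ → ℂ` together with its defining equation
`hP : ∀ x₀ z, P x₀ z = ∑' k, ((iteratedDeriv k G x₀ / k ! : ℝ) : ℂ) * (z - x₀) ^ k`
(no definition is introduced). -/

/-- Norm of the `k`-th term of the complex Taylor series. [folklore] -/
theorem norm_cmTaylor_term (x₀ : ℝ) (z : ℂ) (k : ℕ) :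
    ‖((iteratedDeriv k G x₀ / k ! : ℝ) : ℂ) * (z - x₀) ^ k‖ =
      |iteratedDeriv k G x₀| * ‖z - x₀‖ ^ k / k ! := by
  rw [norm_mul, norm_pow, Complex.norm_real, Real.norm_eq_abs, abs_div,
    Nat.abs_cast]
  ring

/-- On the closed sub-disc `|z - x₀| ≤ ρ < x₀` the terms are dominated by the summable sequence
`(-1)ᵏG⁽ᵏ⁾(x₀) ρᵏ/k!`. [folklore] -/
theorem norm_cmTaylor_term_le (hcm : ∀ (n : ℕ) (t : ℝ), 0 < t → 0 ≤ (-1 : ℝ) ^ n * iteratedDeriv n G t)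
    {x₀ ρ : ℝ} (hx₀ : 0 < x₀) {z : ℂ} (hz : ‖z - x₀‖ ≤ ρ) (k : ℕ) :
    ‖((iteratedDeriv k G x₀ / k ! : ℝ) : ℂ) * (z - x₀) ^ k‖ ≤
      (-1 : ℝ) ^ k * iteratedDeriv k G x₀ * ρ ^ k / k ! := by
  rw [norm_cmTaylor_term, abs_iteratedDeriv_eq hcm k hx₀]
  refine div_le_div_of_nonneg_right (mul_le_mul_of_nonneg_left
    (pow_le_pow_left₀ (norm_nonneg _) hz k) (hcm k x₀ hx₀)) (by positivity)

/-- **The Taylor series of a completely monotone function is holomorphic on the disc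
`|z - x₀| < x₀`.** [cite: Widder1941, Ch. IV Thm. 3a] -/
theorem differentiableOn_cmTaylor (hd : ContDiff ℝ ∞ G)
    (hcm : ∀ (n : ℕ) (t : ℝ), 0 < t → 0 ≤ (-1 : ℝ) ^ n * iteratedDeriv n G t) {P : ℝ → ℂ → ℂ}
    (hP : ∀ (x₀ : ℝ) (z : ℂ), P x₀ z = ∑' k, ((iteratedDeriv k G x₀ / k ! : ℝ) : ℂ) * (z - x₀) ^ k) {x₀ : ℝ} (hx₀ : 0 < x₀) :
    DifferentiableOn ℂ (P x₀) (ball (x₀ : ℂ) x₀) := by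
  have hPf : P x₀ = fun z => ∑' k, ((iteratedDeriv k G x₀ / k ! : ℝ) : ℂ) * (z - x₀) ^ k :=
    funext (hP x₀)
  rw [hPf]
  -- differentiable on every smaller disc, by normal convergence
  have hsub : ∀ ρ : ℝ, 0 ≤ ρ → ρ < x₀ → DifferentiableOn ℂ
      (fun z => ∑' k, ((iteratedDeriv k G x₀ / k ! : ℝ) : ℂ) * (z - x₀) ^ k) (ball (x₀ : ℂ) ρ) := by
    intro ρ hρ hρx
    have hs := (summable_alt_mul_pow hd hcm hρ hρx).1
    refine Complex.differentiableOn_tsum_of_summable_norm hs (fun k => ?_) isOpen_ball fun k w hw => ?_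
    · exact ((differentiable_id.sub_const _).pow k).const_mul _ |>.differentiableOn
    · exact norm_cmTaylor_term_le hcm hx₀ (le_of_lt (by simpa [dist_eq_norm] using hw)) k
  intro z hz
  have hz' : ‖z - x₀‖ < x₀ := by simpa [dist_eq_norm] using hz
  set ρ := (‖z - x₀‖ + x₀) / 2 with hρ
  have h1 : ‖z - x₀‖ < ρ := by rw [hρ]; linarith
  have h2 : ρ < x₀ := by rw [hρ]; linarith
  have hzρ : z ∈ ball (x₀ : ℂ) ρ := by simpa [dist_eq_norm] using h1
  exact ((hsub ρ (by positivity) h2).differentiableAt (isOpen_ball.mem_nhds hzρ)).differentiableWithinAt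

/-- Summability of the complex Taylor series on the disc. [folklore] -/
theorem summable_cmTaylor (hd : ContDiff ℝ ∞ G)
    (hcm : ∀ (n : ℕ) (t : ℝ), 0 < t → 0 ≤ (-1 : ℝ) ^ n * iteratedDeriv n G t)
    {x₀ : ℝ} {z : ℂ} (hz : ‖z - x₀‖ < x₀) :
    Summable (fun k => ‖((iteratedDeriv k G x₀ / k ! : ℝ) : ℂ) * (z - x₀) ^ k‖) := by
  have hx₀ : 0 < x₀ := (norm_nonneg _).trans_lt hz
  have hs := (summable_alt_mul_pow hd hcm (norm_nonneg (z - x₀)) hz).1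
  exact hs.of_nonneg_of_le (fun k => norm_nonneg _) fun k => norm_cmTaylor_term_le hcm hx₀ le_rfl k

/-- **Bound on the disc**: `|P x₀ z| ≤ G(x₀ - |z - x₀|)` for `|z - x₀| < x₀`.
[cite: Widder1941, Ch. IV Thm. 3a] -/
theorem norm_cmTaylor_le (hd : ContDiff ℝ ∞ G)
    (hcm : ∀ (n : ℕ) (t : ℝ), 0 < t → 0 ≤ (-1 : ℝ) ^ n * iteratedDeriv n G t) {P : ℝ → ℂ → ℂ}
    (hP : ∀ (x₀ : ℝ) (z : ℂ), P x₀ z = ∑' k, ((iteratedDeriv k G x₀ / k ! : ℝ) : ℂ) * (z - x₀) ^ k)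
    {x₀ : ℝ} {z : ℂ} (hz : ‖z - x₀‖ < x₀) : ‖P x₀ z‖ ≤ G (x₀ - ‖z - x₀‖) := by
  have hx₀ : 0 < x₀ := (norm_nonneg _).trans_lt hz
  obtain ⟨_, hle⟩ := summable_alt_mul_pow hd hcm (norm_nonneg (z - x₀)) hz
  rw [hP]
  refine (norm_tsum_le_tsum_norm (summable_cmTaylor hd hcm hz)).trans (le_trans ?_ hle)
  refine (summable_cmTaylor hd hcm hz).tsum_le_tsum (fun k => norm_cmTaylor_term_le hcm hx₀ le_rfl k)
    (summable_alt_mul_pow hd hcm (norm_nonneg (z - x₀)) hz).1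

/-- **The Taylor series represents `G` at the real points of `(x₀/2, 2x₀)`** (there the Lagrange
remainder `|G⁽ᴺ⁺¹⁾(ξ)| |t - x₀|ᴺ⁺¹/(N+1)! ≤ (-1)ᴺ⁺¹G⁽ᴺ⁺¹⁾(m) |t-x₀|ᴺ⁺¹/(N+1)!`, `m = min x₀ t`,
is the general term of a convergent series since `|t - x₀| < m`). [cite: Widder1941, Ch. IV Thm. 3a] -/
theorem cmTaylor_ofReal_eq_of_mem_Ioo (hd : ContDiff ℝ ∞ G)
    (hcm : ∀ (n : ℕ) (t : ℝ), 0 < t → 0 ≤ (-1 : ℝ) ^ n * iteratedDeriv n G t) {P : ℝ → ℂ → ℂ}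
    (hP : ∀ (x₀ : ℝ) (z : ℂ), P x₀ z = ∑' k, ((iteratedDeriv k G x₀ / k ! : ℝ) : ℂ) * (z - x₀) ^ k)
    {x₀ t : ℝ} (hx₀ : 0 < x₀) (ht : t ∈ Ioo (x₀ / 2) (2 * x₀)) : P x₀ t = G t := by
  -- the real series and its partial sums
  set d : ℕ → ℝ := fun k => iteratedDeriv k G x₀ / k ! * (t - x₀) ^ k with hdk
  have hcast : P x₀ t = ((∑' k, d k : ℝ) : ℂ) := by
    rw [hP, Complex.ofReal_tsum]
    refine tsum_congr fun k => ?_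
    push_cast [hdk]; ring
  rw [hcast, Complex.ofReal_inj]
  have htx : |t - x₀| < x₀ := by
    rw [abs_lt]; constructor <;> linarith [ht.1, ht.2]
  -- absolute summability of `d`
  have hds : Summable d := by
    have hs := (summable_alt_mul_pow hd hcm (abs_nonneg (t - x₀)) htx).1
    refine Summable.of_norm (hs.of_nonneg_of_le (fun k => norm_nonneg _) fun k => ?_)
    rw [hdk, Real.norm_eq_abs, abs_mul, abs_div, abs_pow, Nat.abs_cast,
      abs_iteratedDeriv_eq hcm k hx₀]
    exact le_of_eq (by ring)
  -- the partial sums converge to `G t`: remainder estimate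
  rcases eq_or_ne t x₀ with rfl | htne
  · -- trivial case `t = x₀`
    have : ∀ k, d k = if k = 0 then G t else 0 := by
      intro k; rcases k with _ | k <;> simp [hdk]
    rw [tsum_congr this, tsum_ite_eq]
  set m := min x₀ t with hm
  have hmpos : 0 < m := lt_min hx₀ (by linarith [ht.1])
  have hρm : |t - x₀| < m := by
    rw [hm, lt_min_iff]; refine ⟨htx, ?_⟩
    rw [abs_lt]; constructor <;> linarith [ht.1, ht.2]
  -- general term of the dominating series at base point `m` tends to zero
  have hterm : Tendsto (fun N => (-1 : ℝ) ^ (N + 1) * iteratedDeriv (N + 1) G m *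
      |t - x₀| ^ (N + 1) / (N + 1)!) atTop (𝓝 0) := by
    have hs := (summable_alt_mul_pow hd hcm (abs_nonneg (t - x₀)) hρm).1
    exact (hs.tendsto_atTop_zero.comp (tendsto_add_atTop_nat 1))
  have hpartial : Tendsto (fun N => ∑ k ∈ Finset.range (N + 1), d k) atTop (𝓝 (G t)) := by
    -- `G t - S_N = R_N` with `|R_N| ≤` the general term above
    have hR : ∀ N : ℕ, |G t - ∑ k ∈ Finset.range (N + 1), d k| ≤
        (-1 : ℝ) ^ (N + 1) * iteratedDeriv (N + 1) G m * |t - x₀| ^ (N + 1) / (N + 1)! := by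
      intro N
      have hcd : ContDiffOn ℝ (N + 1) G (uIcc x₀ t) := (hd.of_le (mod_cast le_top)).contDiffOn
      obtain ⟨ξ, hξ, hrem⟩ := taylor_mean_remainder_lagrange_iteratedDeriv htne.symm hcd
      have huniq : UniqueDiffOn ℝ (uIcc x₀ t) := uniqueDiffOn_Icc (by rw [min_lt_max]; exact htne.symm)
      have hT : taylorWithinEval G N (uIcc x₀ t) x₀ t = ∑ k ∈ Finset.range (N + 1), d k := by
        rw [taylor_within_apply]
        refine Finset.sum_congr rfl fun k _ => ?_
        rw [iteratedDerivWithin_eq_iteratedDeriv huniq (hd.contDiffAt.of_le (mod_cast le_top))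
          left_mem_uIcc, smul_eq_mul, hdk]
        ring
      rw [← hT, hrem]
      -- `ξ` lies strictly between `x₀` and `t`, hence `ξ > m`
      have hξm : m < ξ := by
        rcases lt_or_gt_of_ne htne with h | h
        · have : ξ ∈ Ioo t x₀ := by simpa [uIoo, h.le, min_eq_right, max_eq_left] using hξ
          rw [hm, min_eq_right h.le]; exact this.1
        · have : ξ ∈ Ioo x₀ t := by simpa [uIoo, h.le, min_eq_left, max_eq_right] using hξ
          rw [hm, min_eq_left h.le]; exact this.1
      have hξpos : 0 < ξ := hmpos.trans hξm
      have hanti := alt_antitoneOn hd hcm (N + 1) (mem_Ioi.mpr hmpos) (mem_Ioi.mpr hξpos) hξm.le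
      rw [abs_div, abs_mul, abs_pow, Nat.abs_cast, abs_iteratedDeriv_eq hcm _ hξpos]
      refine div_le_div_of_nonneg_right ?_ (by positivity)
      exact mul_le_mul_of_nonneg_right hanti (pow_nonneg (abs_nonneg _) _)
    rw [Metric.tendsto_atTop]
    intro ε hε
    obtain ⟨N₀, hN₀⟩ := (Metric.tendsto_atTop.mp hterm) ε hε
    refine ⟨N₀, fun N hN => ?_⟩
    rw [Real.dist_eq, abs_sub_comm]
    refine (hR N).trans_lt ?_
    have := hN₀ N hN
    rw [Real.dist_eq, sub_zero] at this
    exact (le_abs_self _).trans_lt this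
  -- conclude by uniqueness of limits
  have h2 : Tendsto (fun N => ∑ k ∈ Finset.range (N + 1), d k) atTop (𝓝 (∑' k, d k)) :=
    hds.hasSum.tendsto_sum_nat.comp (tendsto_add_atTop_nat 1)
  exact tendsto_nhds_unique h2 hpartial

end Literature.Analysis.Complex
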